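import Summits.ValiantsHypothesis.ValiantsHypothesis.Theorems.KPlusLogSqLawWeakLiftingTowerGraftTwoSidedThreeLettersKernels

/-!
# Tower graft line — CLUSTERED UPPER LETTERS: a rank-charged law for the two-sided word with ANY NUMBER of PSD letters above
# the pivot, each no farther above it than the bottom letter is below (part F of the two-sided three-letter series)

Crux `stmt-ValiantsHypothesis-19561`, line (B) `tower_graft`, two-sided word instrument; seat val-sym-lift-p3 g20, `--supports 19561`,
NO stub claimed.  Answers the desk's question (R3004) «does a FOUR-letter analogue of the Gram–Cauchy certificate exist?»: YES when
the upper letters are CLUSTERED — every upper gap `dₗ − e` at most the lower gap `e` (bottom letter at exponent `0`, pivot `J` at `e`) —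
and NO on towers (memo GRAM-CAUCHY-liftp3g20 §5/§7: there the Loewner matrix of `y^p`, `p > m`, has no sign).

THE LAW (`TwoSidedThree.card_negType_le_rank_clustered`).  Word `P₀ + τ^e J + Σₗ τ^{dₗ} Pₗ` with `P₀ ⪰ 0`, `Pₗ ⪰ 0`, `J` ANY
symmetric.  Eliminating the `J`-Gram entry from the kernel relations at two distinct scales gives the CLUSTERED GRAM IDENTITY
`(τᵢ^e − τₖ^e)⟨uᵢ,P₀uₖ⟩ = Σₗ (τᵢ^{dₗ}τₖ^e − τᵢ^eτₖ^{dₗ})⟨uᵢ,Pₗuₖ⟩` (`gramP0_eq_clustered`), i.e.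
`Gram_{P₀} = Σₗ Gram_{Pₗ} ⊙ Nₗ + Δ` with `Nₗ` the Loewner kernel of `s ↦ s^{(dₗ−e)/e}` (`s = τ^e`) and
`Δ = diag(⟨u,P₀u⟩ − Σₗ ((dₗ−e)/e) τ^{dₗ}⟨u,Pₗu⟩)`, which is `> 0` EXACTLY at NEGATIVE-type (entering) roots
(`τ·P_u′(τ) = −e·Δ`).  If every `Nₗ ⪰ 0` — operator-monotone powers: all upper gaps `≤` the lower gap — then
`#entering-type roots ≤ rank P₀ ≤ m` for ANY number of upper letters (abstract certificates as hypotheses, like part C).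
INSTANCE (`card_negType_le_rank_four_letters`): the FOUR-letter word `P₀ + τ²J + τ³B + τ⁴C` (supports `(d₀, d₀+2g, d₀+3g, d₀+4g)`,
`τ = t^g`): `N_B = [τᵢ²τₖ²/(τᵢ+τₖ)]` (Cauchy, part A) and `N_C = [τᵢ²τₖ²]` (rank one) — entering-type roots `≤ rank P₀`.
With `P₀ ≻ 0`, top letter `≻ 0` and definite-type roots the inertia kit's global index formula then gives `Z₊ = 2N⁻ ≤ 2m` exactly as in
parts B/D (census-currency wrapper not typed here).
LOCATED (this seat, hub, g18/g19 zero-forcing instruments, exact re-check): maxima of the word `(+)[J](+)(+)…` — `(0,2,3,4)`: `4 = 2m` at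
`m = 2`, `6 = 2m` at `m = 3`; `(0,4,5,6,7,8)` (SIX letters): `4 = 2m` at `m = 2`; control `(0,2,3,5)` (top gap `3 >` lower gap `2`):
`6 > 2m` at `m = 2` — the clustering condition is sharp in the located data.
HONEST FRAMING: a structural law for clustered supports (not towers); nothing on the four-letter TOWER column, S4…S5, `TowerB`,
`WeakLifting` in its window, Conjecture B, 18050 or `VP ≠ VNP`.  Def-free; Mathlib + parts A/C; axioms standard.

[folklore] Loewner matrices / Cauchy matrices / Schur product theorem.
-/

set_option linter.dupNamespace false
set_option autoImplicit false

namespace Summit.ValiantsHypothesis.ValiantsHypothesis.Theorems.KPlusLogSqLaw.TowerGraft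

open Matrix
open scoped BigOperators

namespace TwoSidedThree

/-! ## §6 CLUSTERED UPPER LETTERS: several PSD letters above the pivot, each no farther above it than the bottom letter is below -/

section Clustered

variable {m : ℕ} {I : Type} [Fintype I] [DecidableEq I] {L : ℕ}

omit [DecidableEq I] in
/-- the quadratic form of a finite sum of matrices. [folklore] -/
theorem dotProduct_sum_mulVec (M : Fin L → Matrix I I ℝ) (x : I → ℝ) :
    x ⬝ᵥ ((∑ l, M l) *ᵥ x) = ∑ l, x ⬝ᵥ (M l *ᵥ x) := by
  rw [Matrix.sum_mulVec, dotProduct_sum]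

omit [DecidableEq I] in
/-- a finite sum of positive semidefinite real matrices is positive semidefinite. [folklore] -/
theorem posSemidef_sum (M : Fin L → Matrix I I ℝ) (hM : ∀ l, (M l).PosSemidef) : (∑ l, M l).PosSemidef := by
  rw [Matrix.posSemidef_iff_dotProduct_mulVec]
  refine ⟨?_, fun x => ?_⟩
  · have h : ∀ l, (M l).IsHermitian := fun l => (hM l).1
    unfold Matrix.IsHermitian at h ⊢
    rw [Matrix.conjTranspose_sum]
    exact Finset.sum_congr rfl fun l _ => h l
  · rw [star_trivial, dotProduct_sum_mulVec]
    exact Finset.sum_nonneg fun l _ => by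
      have h := (Matrix.posSemidef_iff_dotProduct_mulVec.mp (hM l)).2 x
      rwa [star_trivial] at h

variable (P₀ J : Matrix (Fin m) (Fin m) ℝ) (P : Fin L → Matrix (Fin m) (Fin m) ℝ) (e : ℕ) (d : Fin L → ℕ)
  (τ : I → ℝ) (u : I → Fin m → ℝ)

omit [Fintype I] [DecidableEq I] in
/-- kernel relation of the clustered word `P₀ + τ^e J + Σₗ τ^{dₗ} Pₗ`, polarised. [folklore] -/
theorem gram_rel_clustered (hP₀ : P₀.IsSymm) (hJ : J.IsSymm) (hP : ∀ l, (P l).IsSymm)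
    (hker : ∀ i, (P₀ + τ i ^ e • J + ∑ l, τ i ^ d l • P l) *ᵥ u i = 0) (i k : I) :
    u i ⬝ᵥ (P₀ *ᵥ u k) + τ i ^ e * (u i ⬝ᵥ (J *ᵥ u k)) + ∑ l, τ i ^ d l * (u i ⬝ᵥ (P l *ᵥ u k)) = 0 := by
  have h := congrArg (fun w => u k ⬝ᵥ w) (hker i)
  simp only [dotProduct_zero, Matrix.add_mulVec, Matrix.smul_mulVec, Matrix.sum_mulVec, dotProduct_add,
    dotProduct_smul, dotProduct_sum, smul_eq_mul] at h
  rw [form_comm hP₀ (u k) (u i), form_comm hJ (u k) (u i)] at h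
  simp only [form_comm (hP _) (u k) (u i)] at h
  linarith

omit [Fintype I] [DecidableEq I] in
/-- **the clustered Gram identity**: `(τᵢ^e − τₖ^e)·⟨uᵢ,P₀uₖ⟩ = Σₗ (τᵢ^{dₗ}τₖ^e − τᵢ^eτₖ^{dₗ})·⟨uᵢ,Pₗuₖ⟩`. [folklore] -/
theorem gramP0_eq_clustered (hP₀ : P₀.IsSymm) (hJ : J.IsSymm) (hP : ∀ l, (P l).IsSymm)
    (hker : ∀ i, (P₀ + τ i ^ e • J + ∑ l, τ i ^ d l • P l) *ᵥ u i = 0) (i k : I) :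
    (τ i ^ e - τ k ^ e) * (u i ⬝ᵥ (P₀ *ᵥ u k))
      = ∑ l, (τ i ^ d l * τ k ^ e - τ i ^ e * τ k ^ d l) * (u i ⬝ᵥ (P l *ᵥ u k)) := by
  have h1 := gram_rel_clustered P₀ J P e d τ u hP₀ hJ hP hker i k
  have h2 := gram_rel_clustered P₀ J P e d τ u hP₀ hJ hP hker k i
  rw [form_comm hP₀ (u k) (u i), form_comm hJ (u k) (u i)] at h2
  simp only [form_comm (hP _) (u k) (u i)] at h2
  -- `τₖ^e·h1 − τᵢ^e·h2`
  have h3 : (τ i ^ e - τ k ^ e) * (u i ⬝ᵥ (P₀ *ᵥ u k))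
      = τ k ^ e * (∑ l, τ i ^ d l * (u i ⬝ᵥ (P l *ᵥ u k))) - τ i ^ e * ∑ l, τ k ^ d l * (u i ⬝ᵥ (P l *ᵥ u k)) := by
    linear_combination (-(τ k ^ e)) * h1 + (τ i ^ e) * h2
  rw [h3, Finset.mul_sum, Finset.mul_sum, ← Finset.sum_sub_distrib]
  exact Finset.sum_congr rfl fun l _ => by ring

/-- **THE CLUSTERED-UPPER LAW through abstract certificates.**  Word `P₀ + τ^e J + Σₗ τ^{dₗ} Pₗ` (`P₀ ⪰ 0`, `Pₗ ⪰ 0`, `J` ANY symmetric,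
exponents `dₗ` above `e`): kernel pairs `(τᵢ, uᵢ)` at distinct positive scales of NEGATIVE (entering) type — the Rayleigh polynomial is strictly DECREASING
at its root, `e·⟨u,P₀u⟩ > Σₗ (dₗ − e) τ^{dₗ}⟨u,Pₗu⟩` — number at most `rank P₀` as soon as every upper letter carries a positive
semidefinite certificate `Nₗ` with `e·(Nₗ)ᵢᵢ = (dₗ − e)τᵢ^{dₗ}` and `(Nₗ)ᵢₖ(τᵢ^e − τₖ^e) = τᵢ^{dₗ}τₖ^e − τᵢ^eτₖ^{dₗ}` (`i ≠ k`) — the Loewner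
matrix of `s ↦ s^{(dₗ−e)/e}` in `s = τ^e`, positive semidefinite exactly when `dₗ − e ≤ e` (operator monotone power): EVERY UPPER GAP AT MOST
THE LOWER GAP.  Then `Gram_{P₀} = Σₗ Gram_{Pₗ} ⊙ Nₗ + diag(> 0)`, so `Gram_{P₀} ≻ 0`. [folklore] -/
theorem card_negType_le_rank_clustered (hP₀ : P₀.PosSemidef) (hJ : J.IsSymm) (hP : ∀ l, (P l).PosSemidef)
    (hτ : ∀ i, 0 < τ i) (hinj : Function.Injective τ) (he : 0 < e)
    (hker : ∀ i, (P₀ + τ i ^ e • J + ∑ l, τ i ^ d l • P l) *ᵥ u i = 0)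
    (htype : ∀ i, ∑ l, ((d l - e : ℕ) : ℝ) * τ i ^ d l * (u i ⬝ᵥ (P l *ᵥ u i)) < e * (u i ⬝ᵥ (P₀ *ᵥ u i)))
    (N : Fin L → Matrix I I ℝ) (hN : ∀ l, (N l).PosSemidef)
    (hNdiag : ∀ l i, (e : ℝ) * N l i i = ((d l - e : ℕ) : ℝ) * τ i ^ d l)
    (hNoff : ∀ l i k, i ≠ k → N l i k * (τ i ^ e - τ k ^ e) = τ i ^ d l * τ k ^ e - τ i ^ e * τ k ^ d l) :
    Fintype.card I ≤ P₀.rank := by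
  classical
  have hP₀s : P₀.IsSymm := by
    have h1 := hP₀.1; unfold Matrix.IsHermitian at h1
    rwa [Matrix.conjTranspose_eq_transpose_of_trivial] at h1
  have hPs : ∀ l, (P l).IsSymm := by
    intro l; have h1 := (hP l).1; unfold Matrix.IsHermitian at h1
    rwa [Matrix.conjTranspose_eq_transpose_of_trivial] at h1
  have hene : (e : ℝ) ≠ 0 := Nat.cast_ne_zero.mpr (Nat.pos_iff_ne_zero.mp he)
  have hepos : (0 : ℝ) < e := Nat.cast_pos.mpr he
  -- the PSD part `S = Σₗ Gram_{Pₗ} ⊙ Nₗ`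
  set S : Matrix I I ℝ := ∑ l, (Matrix.of fun i' k' => u i' ⬝ᵥ (P l *ᵥ u k')) ⊙ N l with hSdef
  have hS : S.PosSemidef := posSemidef_sum _ fun l => (posSemidef_gram (hP l) u).hadamard (hN l)
  -- the diagonal
  set Δ : I → ℝ := fun i => u i ⬝ᵥ (P₀ *ᵥ u i) - ∑ l, (u i ⬝ᵥ (P l *ᵥ u i)) * N l i i with hΔdef
  have hΔpos : ∀ i, 0 < Δ i := by
    intro i
    have ht := htype i
    have h1 : (e : ℝ) * ∑ l, (u i ⬝ᵥ (P l *ᵥ u i)) * N l i i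
        = ∑ l, ((d l - e : ℕ) : ℝ) * τ i ^ d l * (u i ⬝ᵥ (P l *ᵥ u i)) := by
      rw [Finset.mul_sum]
      refine Finset.sum_congr rfl fun l _ => ?_
      rw [show (e : ℝ) * ((u i ⬝ᵥ (P l *ᵥ u i)) * N l i i) = ((e : ℝ) * N l i i) * (u i ⬝ᵥ (P l *ᵥ u i)) by ring,
        hNdiag l i]
    have h2 : (e : ℝ) * Δ i = e * (u i ⬝ᵥ (P₀ *ᵥ u i)) - ∑ l, ((d l - e : ℕ) : ℝ) * τ i ^ d l * (u i ⬝ᵥ (P l *ᵥ u i)) := by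
      simp only [hΔdef]; rw [mul_sub, h1]
    have h3 : 0 < (e : ℝ) * Δ i := by rw [h2]; linarith
    exact pos_of_mul_pos_right h3 hepos.le
  have hdecomp : (Matrix.of fun i' k' => u i' ⬝ᵥ (P₀ *ᵥ u k')) = S + Matrix.diagonal Δ := by
    ext i k
    rw [Matrix.add_apply, Matrix.of_apply, hSdef, Matrix.sum_apply]
    simp only [Matrix.hadamard_apply, Matrix.of_apply]
    by_cases hik : i = k
    · subst hik
      rw [Matrix.diagonal_apply_eq]
      simp only [hΔdef]; ring
    · rw [Matrix.diagonal_apply_ne _ hik, add_zero]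
      have hne : τ i ^ e - τ k ^ e ≠ 0 := by
        intro h0
        apply hik; apply hinj
        exact (pow_left_inj₀ (hτ i).le (hτ k).le (Nat.pos_iff_ne_zero.mp he)).mp (sub_eq_zero.mp h0)
      have hg := gramP0_eq_clustered P₀ J P e d τ u hP₀s hJ hPs hker i k
      -- multiply the target by the non-zero factor
      apply mul_left_cancel₀ hne
      rw [hg, Finset.mul_sum]
      refine Finset.sum_congr rfl fun l _ => ?_
      rw [← hNoff l i k hik]
      ring
  have hG : (Matrix.of fun i' k' => u i' ⬝ᵥ (P₀ *ᵥ u k')).PosDef := by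
    rw [Matrix.posDef_iff_dotProduct_mulVec]
    refine ⟨(posSemidef_gram hP₀ u).1, fun x hx => ?_⟩
    rw [hdecomp, Matrix.add_mulVec, dotProduct_add]
    have h1 : 0 ≤ star x ⬝ᵥ (S *ᵥ x) := (Matrix.posSemidef_iff_dotProduct_mulVec.mp hS).2 x
    have h2 : 0 < star x ⬝ᵥ (Matrix.diagonal Δ *ᵥ x) := by
      rw [star_trivial]
      simp only [dotProduct, Matrix.mulVec_diagonal]
      obtain ⟨i₀, hi₀⟩ := Function.ne_iff.mp hx
      apply Finset.sum_pos'
      · intro i _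
        have := hΔpos i
        nlinarith [sq_nonneg (x i)]
      · refine ⟨i₀, Finset.mem_univ _, ?_⟩
        have := hΔpos i₀
        have hx0 : 0 < x i₀ ^ 2 := sq_pos_iff.mpr hi₀
        nlinarith
    linarith
  have hrank : (Matrix.of fun i' k' => u i' ⬝ᵥ (P₀ *ᵥ u k')).rank = Fintype.card I := Matrix.rank_of_isUnit _ hG.isUnit
  rw [← hrank]
  exact rank_gram_le P₀ u

/-- **instance: the FOUR-LETTER word on `(d₀, d₀+2g, d₀+3g, d₀+4g)`** (reduced form `P₀ + τ²J + τ³B + τ⁴C`, `τ = t^g`; both upper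
gaps `1, 2 ≤` the lower gap `2`).  Certificates: `N_B = [τᵢ²τₖ²/(τᵢ+τₖ)]` (Cauchy ⊙ rank one) and `N_C = [τᵢ²τₖ²]` (rank one).  Hence the
ENTERING-type kernel pairs (`2⟨u,P₀u⟩ > τ³⟨u,Bu⟩ + 2τ⁴⟨u,Cu⟩`) number at most `rank P₀ ≤ m` — a rank-charged bound for a two-sided
FOUR-letter word (the cell's located maxima on `(0,2,3,4)`: `4 = 2m` at `m = 2`, `6 = 2m` at `m = 3`; on `(0,2,3,5)`, where the top gap
exceeds the lower gap, `6 > 2m` at `m = 2`). [folklore] -/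
theorem card_negType_le_rank_four_letters (B C : Matrix (Fin m) (Fin m) ℝ) (hP₀ : P₀.PosSemidef) (hJ : J.IsSymm)
    (hB : B.PosSemidef) (hC : C.PosSemidef) (hτ : ∀ i, 0 < τ i) (hinj : Function.Injective τ)
    (hker : ∀ i, (P₀ + τ i ^ 2 • J + τ i ^ 3 • B + τ i ^ 4 • C) *ᵥ u i = 0)
    (htype : ∀ i, τ i ^ 3 * (u i ⬝ᵥ (B *ᵥ u i)) + 2 * τ i ^ 4 * (u i ⬝ᵥ (C *ᵥ u i)) < 2 * (u i ⬝ᵥ (P₀ *ᵥ u i))) :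
    Fintype.card I ≤ P₀.rank := by
  classical
  set NB : Matrix I I ℝ := Matrix.of fun i k => τ i ^ 2 * (1 / (τ i + τ k)) * τ k ^ 2 with hNB
  set NC : Matrix I I ℝ := Matrix.vecMulVec (fun i => τ i ^ 2) (fun i => τ i ^ 2) with hNC
  refine card_negType_le_rank_clustered P₀ J ![B, C] 2 ![3, 4] τ u hP₀ hJ ?_ hτ hinj (by norm_num) ?_ ?_ ![NB, NC] ?_ ?_ ?_
  · intro l; fin_cases l
    · exact hB
    · exact hC
  · intro i
    have h := hker i
    rw [Fin.sum_univ_two]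
    simpa [add_assoc] using h
  · intro i
    rw [Fin.sum_univ_two]
    have h := htype i
    simp only [Matrix.cons_val_zero, Matrix.cons_val_one]
    push_cast
    linarith
  · intro l; fin_cases l
    · -- `N_B = D² · Cauchy · D²`
      show NB.PosSemidef
      have hNeq : NB = (Matrix.diagonal fun i => τ i ^ 2) * (Matrix.of fun i k : I => 1 / (τ i + τ k))
          * (Matrix.diagonal fun i => τ i ^ 2) := by
        ext i k
        simp only [hNB, Matrix.of_apply, Matrix.mul_diagonal, Matrix.diagonal_mul]
      rw [hNeq]
      have h := (posSemidef_cauchy τ hτ).conjTranspose_mul_mul_same (Matrix.diagonal fun i => τ i ^ 2)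
      rwa [Matrix.conjTranspose_eq_transpose_of_trivial, Matrix.diagonal_transpose] at h
    · show NC.PosSemidef
      have h := Matrix.posSemidef_vecMulVec_self_star (R := ℝ) (fun i : I => τ i ^ 2)
      rwa [star_trivial] at h
  · intro l i; fin_cases l
    · show (2 : ℝ) * NB i i = ((3 - 2 : ℕ) : ℝ) * τ i ^ 3
      simp only [hNB, Matrix.of_apply]
      have := ne_of_gt (hτ i)
      field_simp
      ring
    · show (2 : ℝ) * NC i i = ((4 - 2 : ℕ) : ℝ) * τ i ^ 4
      simp only [hNC, Matrix.vecMulVec_apply]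
      push_cast
      ring
  · intro l i k hik; fin_cases l
    · show NB i k * (τ i ^ 2 - τ k ^ 2) = τ i ^ 3 * τ k ^ 2 - τ i ^ 2 * τ k ^ 3
      simp only [hNB, Matrix.of_apply]
      have := ne_of_gt (add_pos (hτ i) (hτ k))
      field_simp
      ring
    · show NC i k * (τ i ^ 2 - τ k ^ 2) = τ i ^ 4 * τ k ^ 2 - τ i ^ 2 * τ k ^ 4
      simp only [hNC, Matrix.vecMulVec_apply]
      ring

end Clustered

end TwoSidedThree

end Summit.ValiantsHypothesis.ValiantsHypothesis.Theorems.KPlusLogSqLaw.TowerGraft
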